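import Mathlib
import Literature.Analysis.SpecialFunctions.LegendrePolynomials

/-!
# The zeros of the Legendre polynomials

`P_n` (`Literature.Analysis.SpecialFunctions.legendre n`, Rodrigues' formula) has exactly `n`
distinct real zeros; all of them are simple and all of them lie in the open interval `(-1, 1)`.
This is the Legendre case (`dα = dx` on `[-1, 1]`) of the classical theorem on the zeros of
orthogonal polynomials: Szegő, *Orthogonal Polynomials*, Thm. 3.3.1; Castillo–Petronilho,
*A First Course on Orthogonal Polynomials*, Thm. 3.2 ("the zeros of `P_n` are all real, simple,
and they are located in the interior of `I`").  These zeros are the nodes of the `n`-point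
Gauss–Legendre quadrature rule.

The published proofs argue from orthogonality (a sign count against `∫ P_n π_k dα = 0`); the
proof formalised here is the other classical one, from Rodrigues' formula
`P_n = c_n · dⁿ/dxⁿ (x² - 1)ⁿ` (the tree's definition of `legendre`) by Rolle's theorem:
`(x² - 1)ⁿ` vanishes at `±1` to order `n` (`eval_iterate_derivative_legendreW_eq_zero`), so by
induction its `k`-th derivative, `k ≤ n`, vanishes at `±1` (for `k < n`) and at `k` distinct
interior points, Rolle's theorem interleaving one new zero of the next derivative between any two
consecutive zeros; at `k = n` this gives `n` distinct zeros of `P_n` in `(-1, 1)`, and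
`deg P_n = n` (`natDegree_legendre`) forbids any other root or any multiplicity.

## Main results (namespace `Literature.Analysis.SpecialFunctions`)

* `legendre_roots` — `(legendre n).roots.toFinset.card = n`, `(legendre n).roots.Nodup`, and every
  root lies in `Set.Ioo (-1) 1`.
* `card_roots_legendre` (`n` roots with multiplicity), `rootMultiplicity_legendre_le_one` (all
  simple), `mem_Ioo_of_isRoot_legendre` (all interior), `legendre_eq_C_mul_prod_roots` (`P_n`
  splits over `ℝ`) — the same statement in the usual vocabulary.

## References

* G. Szegő, *Orthogonal Polynomials*, AMS Colloquium Publications 23 (1939; 4th ed. 1975),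
  Thm. 3.3.1. [cite: Szego1939, Thm. 3.3.1]
* K. Castillo, J. Petronilho, *A First Course on Orthogonal Polynomials*, Chapman and Hall/CRC
  (2024), Thm. 3.2, p. 38 of the held copy. [cite: CastilloPetronilho2024, Thm. 3.2]
* G. E. Andrews, R. Askey, R. Roy, *Special Functions* (1999), Remark 2.5.1 (Rodrigues' formula,
  the tree's definition of `legendre`). [cite: AndrewsAskeyRoy1999, Remark 2.5.1]

AI-produced formalisation (H21 engines group, seat eng-cap-1, 2026-08-20); no facts, no axioms
beyond Mathlib's, no `sorry`.
-/

open Polynomial Set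

namespace Literature.Analysis.SpecialFunctions

/-! ### Rolle interleaving -/

/-- Interleaving by Rolle's theorem: if the polynomial `f` vanishes at `a`, at `b` and on a finite
set `T ⊆ (a, b)`, then `f'` vanishes on a finite set `T' ⊆ (a, b)` with `T'.card = T.card + 1`
(induction on `T` from its minimum: Rolle on `[a, min T]`, then recurse on `(min T, b)`).
[folklore] -/
private theorem exists_finset_roots_derivative (f : ℝ[X]) (b : ℝ) (T : Finset ℝ) :
    ∀ a : ℝ, a < b → (∀ t ∈ T, t ∈ Ioo a b) → f.eval a = 0 → f.eval b = 0 →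
      (∀ t ∈ T, f.eval t = 0) →
      ∃ T' : Finset ℝ, (∀ t ∈ T', t ∈ Ioo a b) ∧ T'.card = T.card + 1 ∧
        ∀ t ∈ T', f.derivative.eval t = 0 := by
  classical
  induction T using Finset.induction_on_min with
  | empty =>
    intro a hab _ hfa hfb _
    obtain ⟨c, hc, hc0⟩ := exists_deriv_eq_zero (f := fun x => f.eval x) hab
      f.continuous.continuousOn (by simp only [hfa, hfb])
    refine ⟨{c}, by simpa using hc, by simp, ?_⟩
    intro t ht
    rw [Finset.mem_singleton] at ht
    subst ht
    rwa [Polynomial.deriv] at hc0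
  | insert t s hlt ih =>
    intro a hab hsub hfa hfb hzero
    have htab : t ∈ Ioo a b := hsub t (Finset.mem_insert_self t s)
    have hft : f.eval t = 0 := hzero t (Finset.mem_insert_self t s)
    obtain ⟨c, hc, hc0⟩ := exists_deriv_eq_zero (f := fun x => f.eval x) htab.1
      f.continuous.continuousOn (by simp only [hfa, hft])
    rw [Polynomial.deriv] at hc0
    obtain ⟨T'', hT''sub, hT''card, hT''zero⟩ := ih t htab.2
      (fun x hx => ⟨hlt x hx, (hsub x (Finset.mem_insert_of_mem hx)).2⟩) hft hfb
      (fun x hx => hzero x (Finset.mem_insert_of_mem hx))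
    have hcT'' : c ∉ T'' := fun h => lt_irrefl c (hc.2.trans (hT''sub c h).1)
    refine ⟨insert c T'', ?_, ?_, ?_⟩
    · intro x hx
      rcases Finset.mem_insert.mp hx with rfl | hx
      · exact ⟨hc.1, hc.2.trans htab.2⟩
      · exact ⟨htab.1.trans (hT''sub x hx).1, (hT''sub x hx).2⟩
    · rw [Finset.card_insert_of_notMem hcT'', hT''card, Finset.card_insert_of_notMem]
      exact fun h => lt_irrefl t (hlt t h)
    · intro x hx
      rcases Finset.mem_insert.mp hx with rfl | hx
      · exact hc0
      · exact hT''zero x hx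

/-- For `k ≤ n`, the `k`-th derivative of `W_n = (X² - 1)ⁿ` has (at least) `k` distinct zeros
in `(-1, 1)` (Rodrigues–Rolle induction). [folklore] -/
private theorem exists_finset_roots_iterate_derivative_legendreW (n : ℕ) :
    ∀ k ≤ n, ∃ T : Finset ℝ, (∀ t ∈ T, t ∈ Ioo (-1 : ℝ) 1) ∧ T.card = k ∧
      ∀ t ∈ T, (derivative^[k] (legendreW n)).eval t = 0 := by
  intro k hk
  induction k with
  | zero => exact ⟨∅, by simp, by simp, by simp⟩
  | succ k ih =>
    obtain ⟨T, hTsub, hTcard, hTzero⟩ := ih (Nat.le_of_succ_le hk)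
    have h1 := eval_iterate_derivative_legendreW_eq_zero (n := n) (j := k) hk
    obtain ⟨T', hT'sub, hT'card, hT'zero⟩ :=
      exists_finset_roots_derivative (derivative^[k] (legendreW n)) 1 T (-1) (by norm_num)
        hTsub h1.2 h1.1 hTzero
    refine ⟨T', hT'sub, by rw [hT'card, hTcard], fun t ht => ?_⟩
    rw [Function.iterate_succ_apply']
    exact hT'zero t ht

/-! ### The theorem -/

/-- **The zeros of the Legendre polynomial** (Szegő, Thm. 3.3.1 / Castillo–Petronilho, Thm. 3.2,
for `dα = dx` on `[-1, 1]`): `P_n` has exactly `n` distinct real zeros, they are simple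
(`roots.Nodup`), and they all lie in the open interval `(-1, 1)`.  Proof by Rodrigues' formula and
Rolle's theorem (module docstring). [cite: Szego1939, Thm. 3.3.1]
[cite: CastilloPetronilho2024, Thm. 3.2] -/
theorem legendre_roots (n : ℕ) :
    (legendre n).roots.toFinset.card = n ∧ (legendre n).roots.Nodup ∧
      ∀ x ∈ (legendre n).roots, x ∈ Ioo (-1 : ℝ) 1 := by
  classical
  obtain ⟨T, hTsub, hTcard, hTzero⟩ :=
    exists_finset_roots_iterate_derivative_legendreW n n le_rfl
  have hp0 : legendre n ≠ 0 := legendre_ne_zero n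
  have hTroots : T ⊆ (legendre n).roots.toFinset := by
    intro t ht
    rw [Multiset.mem_toFinset, mem_roots hp0, IsRoot.def, legendre, eval_mul, eval_C,
      hTzero t ht, mul_zero]
  have hcard_le : (legendre n).roots.toFinset.card ≤ n :=
    (Multiset.toFinset_card_le _).trans ((card_roots' _).trans (natDegree_legendre n).le)
  have hcardT : n ≤ (legendre n).roots.toFinset.card :=
    calc n = T.card := hTcard.symm
      _ ≤ _ := Finset.card_le_card hTroots
  have heq : (legendre n).roots.toFinset = T :=
    (Finset.eq_of_subset_of_card_le hTroots (by rw [hTcard]; exact hcard_le)).symm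
  have hcard : (legendre n).roots.toFinset.card = n := le_antisymm hcard_le hcardT
  have hdedup : (legendre n).roots.dedup = (legendre n).roots :=
    Multiset.eq_of_le_of_card_le (Multiset.dedup_le _) (by
      calc Multiset.card (legendre n).roots
          ≤ n := (card_roots' _).trans (natDegree_legendre n).le
        _ = Multiset.card (legendre n).roots.dedup := by rw [← Multiset.card_toFinset, hcard])
  refine ⟨hcard, hdedup ▸ Multiset.nodup_dedup _, fun x hx => ?_⟩
  have hx' : x ∈ (legendre n).roots.toFinset := Multiset.mem_toFinset.mpr hx
  rw [heq] at hx'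
  exact hTsub x hx'

/-- `P_n` has `n` real roots counted with multiplicity. [cite: Szego1939, Thm. 3.3.1]
[cite: CastilloPetronilho2024, Thm. 3.2] -/
theorem card_roots_legendre (n : ℕ) : Multiset.card (legendre n).roots = n := by
  classical
  obtain ⟨hcard, hnd, -⟩ := legendre_roots n
  rwa [Multiset.toFinset_card_of_nodup hnd] at hcard

/-- Every zero of `P_n` is simple. [cite: Szego1939, Thm. 3.3.1]
[cite: CastilloPetronilho2024, Thm. 3.2] -/
theorem rootMultiplicity_legendre_le_one (n : ℕ) (x : ℝ) :
    (legendre n).rootMultiplicity x ≤ 1 := by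
  classical
  rw [← count_roots]
  exact Multiset.nodup_iff_count_le_one.mp (legendre_roots n).2.1 x

/-- Every zero of `P_n` lies in `(-1, 1)`. [cite: Szego1939, Thm. 3.3.1]
[cite: CastilloPetronilho2024, Thm. 3.2] -/
theorem mem_Ioo_of_isRoot_legendre {n : ℕ} {x : ℝ} (hx : (legendre n).IsRoot x) :
    x ∈ Ioo (-1 : ℝ) 1 :=
  (legendre_roots n).2.2 x ((mem_roots (legendre_ne_zero n)).mpr hx)

/-- `P_n` splits over `ℝ`: it is its leading coefficient times `∏ (X - xᵢ)` over its `n`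
roots.
[cite: Szego1939, Thm. 3.3.1] [cite: CastilloPetronilho2024, Thm. 3.2] -/
theorem legendre_eq_C_mul_prod_roots (n : ℕ) :
    legendre n =
      C (legendre n).leadingCoeff * ((legendre n).roots.map fun a => X - C a).prod :=
  (C_leadingCoeff_mul_prod_multiset_X_sub_C
    ((card_roots_legendre n).trans (natDegree_legendre n).symm)).symm

end Literature.Analysis.SpecialFunctions
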